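import Summits.Ventures.Crystal3D.Theorems.StickyWulffConstantCoaxialWallLawFluxGapCell
import Summits.Ventures.Crystal3D.Theorems.StickyWulffConstantCoaxialWallLawFluxGap
import Summits.Ventures.Crystal3D.Theorems.StickyWulffConstantCoaxialWallLawTerracePropagation
import Summits.Ventures.Crystal3D.Theorems.StickyWulffConstantCoaxialWallLawInteriorLedger
import Summits.Ventures.Crystal3D.Theorems.StickyWulffConstantCoaxialWallLawHaggConst
import Summits.Ventures.Crystal3D.Theorems.StickyWulffConstantGenericWallFloorCoaxialIff
import Summits.Ventures.Crystal3D.Theorems.StickyWulffConstantGenericWallFloorSampleDeficitUpper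
import Summits.Ventures.Crystal3D.Theorems.StickyWulffConstantGenericWallFloorRigidRung
import Summits.Ventures.Crystal3D.Theorems.StickyWulffConstantNoReconstructionGainLatticeAdhesion
import HarnessLib

/-!
# The flux-gap rung of `stub_coaxialTwoSlabAdhesion`: general fillings, twin pairs, modulo foreign twin dozens

HONEST FRAMING. Part of the venture `Summits/Ventures/Crystal3D` (cell `crystal3d-full`), helper
`--supports` the crux `CoaxialWallLaw` (stmt-Ventures-19481, `route-Ventures-StickyWulffConstant`),
REGISTERED line `WallLedgerF` (planner cf-p1 gen 16), open stub `stub_coaxialTwoSlabAdhesion`.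
RUNG CREDIT ONLY — this is NOT the stub: it is the stub's inequality for ARBITRARY fillings `X` of the
cell and co-axial TWIN pairs (`A₁·Λ₀ ≠ A₂·Λ₀`), in the regime `cos² θ = ⟪L e₃, e₃⟫² ≥ 9/25`, with the
crux's constant `½` replaced by `√6/156`, with the kissing facts `KissingGap δ` / `KissingClassification δ`
taken BY NAME (inputs, as everywhere on this line), and MODULO an explicit residual: `1/26` times the
number of balls of `X` that are FOREIGN TWIN DOZENS — centres `b` whose closed lower half-dozen in one
of the two frames `G ∈ {L, L∘R}` is present, whose open upper half-dozen is absent, and whose mirror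
images across a `{111}` plane of `G` with unit normal `n' ≠ ±L e₃` (a twin plane OTHER than the
lamination plane) are present.  For fillings without such configurations (in particular for every
filling whose coherent pieces are the two grains and their twins across the lamination plane only) the
residual vanishes.  Brick 12 (assembly) of the FLUX-GAP architecture (memo F-FLUXGAP-ARCH, evidence #7 on
the crux item).

**Theorem (`coaxialTwoSlabAdhesion_general_twin_fluxGap`).**  Under the crux's co-axiality data
(`L, s₁, s₂, σ, σ'`), `A₁·Λ₀ ≠ A₂·Λ₀` and `9/25 ≤ ⟪L e₃, e₃⟫²`: there are `C` and `R₀ = 10` such that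
for every `h ≥ 0`, `ρ ≥ R₀`, every `1`-separated `X` in the cell with the two complete slab samples
`P₁ ⊆ X`, `P₂ ⊆ X ∖ P₁`,
`cross(P₁, X∖P₁) + cross(P₂, Y) ≤ D(Y) + (φ₁ + φ₂ − (√6/156)·√(1 − ⟪L e₃, e₃⟫²)) π ρ² + (1/26)·#FOREIGN + C (1 + h) ρ`.

Proof.  `cross₁ + cross₂ = D(P₁) + D(P₂) + D(Y) − D(X)` (`contactDeficiency_sdiff_split` twice);
`D(Pᵢ) ≤ 2φᵢ π ρ² + Cᵢ ρ` (`affineSampleDeficit_upper`); `2 D(X) ≥ 2φ₁πρ² + 2φ₂πρ² + #{deg ≠ 12 in the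
interior window} − O((1+h)ρ)` (`ledger_ge_faces_add_interior`); and the payers of the interior window are
fed by the flux gap: `26·#{deg ≤ 11} + 2·#FOREIGN ≥ √2 (α₁ − α₂) π ρ² − O((1+h)ρ)`
(`fluxGap_twin_payers_ge`, the line automaton), where `α₁ − α₂ = 2δ⋆` for the steep far slot `u⋆`
(`exists_far_slot_steep`: `√(1 − cos²θ) ≤ 2√3 δ⋆`), so `√2 (α₁ − α₂) ≥ (√6/3) sin θ`; both designated
slots rise because `3δ⋆² ≤ sin²θ < 2cos²θ` (`far_deviation_identity`, `cos²θ ≥ 9/25 > 1/3`).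

WHAT THIS IS NOT: not the stub (translation pairs `A₁·Λ₀ = A₂·Λ₀`, the regime `cos²θ < 9/25`, and the
foreign-twin-dozen residual are not covered; constant `√6/156 < ½`); F-C1 not moved.
-/

noncomputable section

namespace Summit.Ventures.Crystal3D.Theorems

open Summit.Ventures.Crystal3D Finset
open Literature.MathematicalPhysics.StatisticalMechanics (fccStacking barlowStacking IsHaggSeq
  contactDeficiency)
open scoped InnerProductSpace

open scoped Classical in
/-- **The flux-gap rung of `stub_coaxialTwoSlabAdhesion` (general fillings, twin pairs, `cos²θ ≥ 9/25`,
modulo foreign twin dozens).**  See the module docstring. -/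
theorem coaxialTwoSlabAdhesion_general_twin_fluxGap {δ : ℝ} (hg : KissingGap δ) (hc : KissingClassification δ)
    (A₁ : EuclideanSpace ℝ (Fin 3) ≃ₗᵢ[ℝ] EuclideanSpace ℝ (Fin 3)) (t₁ : EuclideanSpace ℝ (Fin 3))
    (A₂ : EuclideanSpace ℝ (Fin 3) ≃ₗᵢ[ℝ] EuclideanSpace ℝ (Fin 3)) (t₂ : EuclideanSpace ℝ (Fin 3))
    (L : EuclideanSpace ℝ (Fin 3) ≃ₗᵢ[ℝ] EuclideanSpace ℝ (Fin 3)) (s₁ s₂ : EuclideanSpace ℝ (Fin 3))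
    (σ σ' : ℤ → ℤ) (hσ : IsHaggSeq σ) (hσ' : IsHaggSeq σ')
    (hsub₁ : (fun p => A₁ p + t₁) '' fccStacking 1 (Real.sqrt (2 / 3)) ⊆
      (fun p => L p + s₁) '' barlowStacking 1 (Real.sqrt (2 / 3)) σ)
    (hsub₂ : (fun p => A₂ p + t₂) '' fccStacking 1 (Real.sqrt (2 / 3)) ⊆
      (fun p => L p + s₂) '' barlowStacking 1 (Real.sqrt (2 / 3)) σ')
    (htwin : A₁ '' fccStacking 1 (Real.sqrt (2 / 3)) ≠ A₂ '' fccStacking 1 (Real.sqrt (2 / 3)))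
    (hreg : 9 / 25 ≤ ⟪L (EuclideanSpace.single (2 : Fin 3) (1 : ℝ)),
      (EuclideanSpace.single (2 : Fin 3) (1 : ℝ))⟫_ℝ ^ 2) :
    ∃ C R₀ : ℝ, 1 ≤ R₀ ∧ ∀ h : ℝ, 0 ≤ h → ∀ ρ : ℝ, R₀ ≤ ρ →
      ∀ X P₁ P₂ : Finset (EuclideanSpace ℝ (Fin 3)),
      (∀ p ∈ X, ∀ q ∈ X, p ≠ q → 1 ≤ dist p q) → P₁ ⊆ X → P₂ ⊆ X \ P₁ →
      (∀ p ∈ X, -(2 * R₀) ≤ p 2 ∧ p 2 ≤ h + 2 * R₀ ∧ p 0 ^ 2 + p 1 ^ 2 ≤ ρ ^ 2) →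
      (∀ p, p ∈ P₁ ↔ (p ∈ (fun q => A₁ q + t₁) '' fccStacking 1 (Real.sqrt (2 / 3)) ∧
        -(2 * R₀) ≤ p 2 ∧ p 2 ≤ -R₀ ∧ p 0 ^ 2 + p 1 ^ 2 ≤ ρ ^ 2)) →
      (∀ p, p ∈ P₂ ↔ (p ∈ (fun q => A₂ q + t₂) '' fccStacking 1 (Real.sqrt (2 / 3)) ∧
        h + R₀ ≤ p 2 ∧ p 2 ≤ h + 2 * R₀ ∧ p 0 ^ 2 + p 1 ^ 2 ≤ ρ ^ 2)) →
      ((((P₁ ×ˢ (X \ P₁)).filter fun pq => dist pq.1 pq.2 = 1).card : ℕ) : ℝ) +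
        ((((P₂ ×ˢ ((X \ P₁) \ P₂)).filter fun pq => dist pq.1 pq.2 = 1).card : ℕ) : ℝ) ≤
        contactDeficiency ((X \ P₁) \ P₂) +
          (Real.sqrt 2 / 4 * ∑ᶠ w ∈ {w ∈ fccStacking 1 (Real.sqrt (2 / 3)) | ‖w‖ = 1},
              |⟪w, A₁.symm (EuclideanSpace.single (2 : Fin 3) (1 : ℝ))⟫_ℝ| +
            Real.sqrt 2 / 4 * ∑ᶠ w ∈ {w ∈ fccStacking 1 (Real.sqrt (2 / 3)) | ‖w‖ = 1},
              |⟪w, A₂.symm (EuclideanSpace.single (2 : Fin 3) (1 : ℝ))⟫_ℝ| -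
            (Real.sqrt 6 / 156 : ℝ) * Real.sqrt (1 - ⟪L (EuclideanSpace.single (2 : Fin 3) (1 : ℝ)),
              (EuclideanSpace.single (2 : Fin 3) (1 : ℝ))⟫_ℝ ^ 2)) * Real.pi * ρ ^ 2 +
          (1 / 26 : ℝ) * ((X.filter fun b =>
            ∃ G : EuclideanSpace ℝ (Fin 3) ≃ₗᵢ[ℝ] EuclideanSpace ℝ (Fin 3),
              (G = L ∨ G = (ℝ ∙ EuclideanSpace.single (2 : Fin 3) (1 : ℝ)).reflection.trans L) ∧
              ∃ n' : EuclideanSpace ℝ (Fin 3), ‖n'‖ = 1 ∧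
                n' ≠ L (EuclideanSpace.single (2 : Fin 3) (1 : ℝ)) ∧
                n' ≠ -L (EuclideanSpace.single (2 : Fin 3) (1 : ℝ)) ∧
                (∀ w ∈ fccSlots, ⟪G w, n'⟫_ℝ = 0 ∨ ⟪G w, n'⟫_ℝ = Real.sqrt (2 / 3) ∨
                  ⟪G w, n'⟫_ℝ = -Real.sqrt (2 / 3)) ∧
                (∀ w ∈ fccSlots, ⟪G w, n'⟫_ℝ ≤ 0 → b + G w ∈ X) ∧
                (∀ w ∈ fccSlots, ⟪G w, n'⟫_ℝ < 0 → b + (G w - (2 * ⟪G w, n'⟫_ℝ) • n') ∈ X) ∧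
                (∀ w ∈ fccSlots, 0 < ⟪G w, n'⟫_ℝ → b + G w ∉ X)).card : ℝ) +
          C * (1 + h) * ρ := by
  set e₃ : EuclideanSpace ℝ (Fin 3) := EuclideanSpace.single (2 : Fin 3) (1 : ℝ) with he₃
  set RL : EuclideanSpace ℝ (Fin 3) ≃ₗᵢ[ℝ] EuclideanSpace ℝ (Fin 3) :=
    (ℝ ∙ EuclideanSpace.single (2 : Fin 3) (1 : ℝ)).reflection.trans L with hRL
  have hr : 0 < Real.sqrt (2 / 3) := Real.sqrt_pos.2 (by norm_num)
  have he₃1 : ‖e₃‖ = 1 := by rw [he₃, PiLp.norm_single, norm_one]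
  obtain ⟨C₁, hC₁⟩ := affineSampleDeficit_upper A₁ t₁ 10 (by norm_num)
  obtain ⟨C₂, hC₂⟩ := affineSampleDeficit_upper A₂ t₂ 10 (by norm_num)
  -- the pair is a twin pair in the frame: `σ 0 ≠ σ' 0`
  have htw : σ 0 ≠ σ' 0 := by
    intro heq
    obtain ⟨-, e₁⟩ := linear_image_eq_frame_of_subset A₁ L t₁ s₁ hσ hsub₁
    obtain ⟨-, e₂⟩ := linear_image_eq_frame_of_subset A₂ L t₂ s₂ hσ' hsub₂
    exact htwin (by rw [e₁, e₂, heq])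
  -- normal form: the grains are `F false·Λ₀ + s₁`, `F true·Λ₀ + s₂` with `{F false, F true} = {L, L∘R}`
  have hnorm : ∃ F : Bool → (EuclideanSpace ℝ (Fin 3) ≃ₗᵢ[ℝ] EuclideanSpace ℝ (Fin 3)),
      ((F false = L ∧ F true = RL) ∨ (F false = RL ∧ F true = L)) ∧
      (fun q => A₁ q + t₁) '' fccStacking 1 (Real.sqrt (2 / 3)) =
        (fun q => F false q + s₁) '' fccStacking 1 (Real.sqrt (2 / 3)) ∧
      (fun q => A₂ q + t₂) '' fccStacking 1 (Real.sqrt (2 / 3)) =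
        (fun q => F true q + s₂) '' fccStacking 1 (Real.sqrt (2 / 3)) := by
    rcases hσ 0 with h1 | hm1
    · have hm1' : σ' 0 = -1 := (hσ' 0).resolve_left fun h' => htw (h1.trans h'.symm)
      have e₁ := coaxial_frame_eq_fcc_of_one A₁ t₁ L s₁ hσ hsub₁ h1
      obtain ⟨e₂, -⟩ := coaxial_frame_eq_fcc_of_neg_one A₂ t₂ L s₂ hσ' hsub₂ hm1'
      exact ⟨fun c => cond c RL L, Or.inl ⟨rfl, rfl⟩, e₁, e₂⟩
    · have h1' : σ' 0 = 1 := (hσ' 0).resolve_right fun h' => htw (hm1.trans h'.symm)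
      obtain ⟨e₁, -⟩ := coaxial_frame_eq_fcc_of_neg_one A₁ t₁ L s₁ hσ hsub₁ hm1
      have e₂ := coaxial_frame_eq_fcc_of_one A₂ t₂ L s₂ hσ' hsub₂ h1'
      exact ⟨fun c => cond c L RL, Or.inr ⟨rfl, rfl⟩, e₁, e₂⟩
  obtain ⟨F, hF, e₁, e₂⟩ := hnorm
  -- the axis, oriented upwards: `n = ±L e₃` with `⟪n, e₃⟫ = |cos θ| ≥ 3/5`
  obtain ⟨n, hn, hcn⟩ : ∃ n : EuclideanSpace ℝ (Fin 3), (n = L e₃ ∨ n = -L e₃) ∧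
      ⟪n, e₃⟫_ℝ = |⟪L e₃, e₃⟫_ℝ| := by
    by_cases h0 : 0 ≤ ⟪L e₃, e₃⟫_ℝ
    · exact ⟨L e₃, Or.inl rfl, (abs_of_nonneg h0).symm⟩
    · refine ⟨-L e₃, Or.inr rfl, ?_⟩
      rw [inner_neg_left, abs_of_neg (lt_of_not_ge h0)]
  have hn1 : ‖n‖ = 1 := by
    rcases hn with h' | h'
    · rw [h', LinearIsometryEquiv.norm_map, he₃1]
    · rw [h', norm_neg, LinearIsometryEquiv.norm_map, he₃1]
  have hc35 : 3 / 5 ≤ ⟪n, e₃⟫_ℝ := by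
    rw [hcn, ← Real.sqrt_sq_eq_abs, show (3 / 5 : ℝ) = Real.sqrt ((3 / 5) ^ 2) by
      rw [Real.sqrt_sq (by norm_num)]]
    exact Real.sqrt_le_sqrt (by norm_num [hreg])
  have hcsq : ⟪n, e₃⟫_ℝ ^ 2 = ⟪L e₃, e₃⟫_ℝ ^ 2 := by rw [hcn, sq_abs]
  have hrc : 0 < Real.sqrt (2 / 3) * ⟪n, e₃⟫_ℝ := mul_pos hr (by linarith)
  -- menu of the frames along the axis
  have hax : ∀ c w, ⟪F c w, L e₃⟫_ℝ = w 2 := by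
    intro c w
    rcases hF with ⟨h0, h1⟩ | ⟨h0, h1⟩ <;> cases c <;> simp only [h0, h1]
    · exact inner_frame_axis L w
    · exact inner_twinFrame_axis L w
    · exact inner_twinFrame_axis L w
    · exact inner_frame_axis L w
  have hmenu0 : ∀ w ∈ fccSlots, ⟪F false w, n⟫_ℝ = 0 ∨ ⟪F false w, n⟫_ℝ = Real.sqrt (2 / 3) ∨
      ⟪F false w, n⟫_ℝ = -Real.sqrt (2 / 3) := by
    intro w hw
    have h : ⟪F false w, n⟫_ℝ = w 2 ∨ ⟪F false w, n⟫_ℝ = -w 2 := by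
      rcases hn with h' | h'
      · exact Or.inl (by rw [h', hax])
      · exact Or.inr (by rw [h', inner_neg_right, hax])
    rcases h with h | h <;> rcases slot_apply_two_cases hw with h' | h' | h' <;> rw [h, h']
    · exact Or.inl rfl
    · exact Or.inr (Or.inl rfl)
    · exact Or.inr (Or.inr rfl)
    · exact Or.inl neg_zero
    · exact Or.inr (Or.inr rfl)
    · exact Or.inr (Or.inl (neg_neg _))
  -- the far frame of the bottom grain and its steep far slot `u`
  obtain ⟨u₁, hu₁, u₂, hu₂, u₃, hu₃, hn₁, hn₂, hn₃, i12, i13, i23, -, -⟩ :=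
    exists_far_frame (F false) hn1 hmenu0
  obtain ⟨u, hu, hδ0, hSδ⟩ := exists_far_slot_steep (F false) hn1 he₃1 hu₁ hu₂ hu₃ hn₁ hn₂ hn₃ i12 i13 i23
  have i21 : ⟪u₂, u₁⟫_ℝ = 1 / 2 := by rw [real_inner_comm]; exact i12
  have i31 : ⟪u₃, u₁⟫_ℝ = 1 / 2 := by rw [real_inner_comm]; exact i13
  have i32 : ⟪u₃, u₂⟫_ℝ = 1 / 2 := by rw [real_inner_comm]; exact i23
  obtain ⟨huS, hun, h3δ⟩ : u ∈ fccSlots ∧ ⟪F false u, n⟫_ℝ = Real.sqrt (2 / 3) ∧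
      3 * (⟪F false u, e₃⟫_ℝ - Real.sqrt (2 / 3) * ⟪n, e₃⟫_ℝ) ^ 2 ≤ 1 - ⟪n, e₃⟫_ℝ ^ 2 := by
    simp only [mem_insert, mem_singleton] at hu
    rcases hu with rfl | rfl | rfl
    · have hid := far_deviation_identity (F false) hn1 he₃1 hu₁ hu₂ hu₃ hn₁ hn₂ hn₃ i12 i13 i23
      exact ⟨hu₁, hn₁, by linarith [hid, sq_nonneg (⟪F false u₂, e₃⟫_ℝ - ⟪F false u₃, e₃⟫_ℝ)]⟩
    · have hid := far_deviation_identity (F false) hn1 he₃1 hu₂ hu₁ hu₃ hn₂ hn₁ hn₃ i21 i23 i13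
      exact ⟨hu₂, hn₂, by linarith [hid, sq_nonneg (⟪F false u₁, e₃⟫_ℝ - ⟪F false u₃, e₃⟫_ℝ)]⟩
    · have hid := far_deviation_identity (F false) hn1 he₃1 hu₃ hu₁ hu₂ hn₃ hn₁ hn₂ i31 i32 i12
      exact ⟨hu₃, hn₃, by linarith [hid, sq_nonneg (⟪F false u₁, e₃⟫_ℝ - ⟪F false u₂, e₃⟫_ℝ)]⟩
  set dd : ℝ := ⟪F false u, e₃⟫_ℝ - Real.sqrt (2 / 3) * ⟪n, e₃⟫_ℝ with hdd
  -- the two designated slots: `α₁ = (F false u)₂ = √(2/3) cos θ + δ⋆`, `α₂ = (F true u)₂ = √(2/3) cos θ − δ⋆`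
  have h2a : (F false u) 2 = ⟪F false u, e₃⟫_ℝ := apply_two_eq_inner_e₃ _
  have hn2 : n 2 = ⟪n, e₃⟫_ℝ := apply_two_eq_inner_e₃ _
  have hα₁eq : (F false u) 2 = Real.sqrt (2 / 3) * ⟪n, e₃⟫_ℝ + dd := by rw [h2a, hdd]; ring
  have key : F true u = F false (-u) - (2 * ⟪F false (-u), n⟫_ℝ) • n := by
    rcases hF with ⟨h0, h1⟩ | ⟨h0, h1⟩
    · rw [h0, h1]
      have := twinFrame_neg_eq L hn (-u)
      rwa [neg_neg] at this
    · rw [h0, h1]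
      have := frame_neg_eq L hn (-u)
      rwa [neg_neg] at this
  have hmirror : F true u = -F false u + (2 * ⟪F false u, n⟫_ℝ) • n := by
    rw [key, map_neg, inner_neg_left, mul_neg, neg_smul, sub_neg_eq_add]
  have hα₂eq : (F true u) 2 = Real.sqrt (2 / 3) * ⟪n, e₃⟫_ℝ - dd := by
    have h1 : (F true u) 2 = -(F false u) 2 + 2 * ⟪F false u, n⟫_ℝ * n 2 := by
      rw [hmirror]
      simp only [PiLp.add_apply, PiLp.neg_apply, PiLp.smul_apply, smul_eq_mul]
    rw [h1, hun, hn2, h2a, hdd]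
    ring
  have hα₁pos : 0 < (F false u) 2 := by rw [hα₁eq]; linarith only [hδ0, hrc]
  have hr2 : Real.sqrt (2 / 3) ^ 2 = 2 / 3 := Real.sq_sqrt (by norm_num)
  have hα₂pos : 0 < (F true u) 2 := by
    rw [hα₂eq]
    have hc2 : 9 / 25 ≤ ⟪n, e₃⟫_ℝ ^ 2 := by rw [hcsq]; exact hreg
    have h1 : dd ^ 2 < (Real.sqrt (2 / 3) * ⟪n, e₃⟫_ℝ) ^ 2 := by
      rw [mul_pow, hr2]; linarith only [h3δ, hc2]
    have h2 := abs_lt_of_sq_lt_sq h1 hrc.le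
    linarith only [h2, le_abs_self dd]
  have hdiff : (F false u) 2 - (F true u) 2 = 2 * dd := by rw [hα₁eq, hα₂eq]; ring
  -- the flux gap beats `(√6/3) sin θ`
  have h63 : Real.sqrt 6 / 3 * Real.sqrt (1 - ⟪L e₃, e₃⟫_ℝ ^ 2) ≤ Real.sqrt 2 * (2 * dd) := by
    have hs6 : Real.sqrt 6 = Real.sqrt 2 * Real.sqrt 3 := by
      rw [← Real.sqrt_mul (by norm_num : (0 : ℝ) ≤ 2)]; norm_num
    have hs3 : Real.sqrt 3 * Real.sqrt 3 = 3 := Real.mul_self_sqrt (by norm_num)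
    rw [hcsq] at hSδ
    calc Real.sqrt 6 / 3 * Real.sqrt (1 - ⟪L e₃, e₃⟫_ℝ ^ 2)
        = Real.sqrt 2 * Real.sqrt 3 / 3 * Real.sqrt (1 - ⟪L e₃, e₃⟫_ℝ ^ 2) := by rw [hs6]
      _ ≤ Real.sqrt 2 * Real.sqrt 3 / 3 * (2 * Real.sqrt 3 * dd) :=
          mul_le_mul_of_nonneg_left hSδ (by positivity)
      _ = Real.sqrt 2 * (2 * dd) * (Real.sqrt 3 * Real.sqrt 3 / 3) := by ring
      _ = Real.sqrt 2 * (2 * dd) := by rw [hs3]; ring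
  -- the constant
  have hCE0 : (0 : ℝ) ≤ 12 * Real.sqrt 2 * Real.pi + 2 * Real.sqrt 2 * Real.pi * ((10 - 1) / 2 + 4) +
      36 * 10 + 288 := by norm_num; positivity
  have hCK0 : (0 : ℝ) ≤ Real.sqrt 2 * Real.pi * ((10 - 1) / 2 + 4) ^ 2 / (F true u) 2 :=
    div_nonneg (by positivity) hα₂pos.le
  refine ⟨|C₁| + |C₂| + (240 * Real.sqrt 2 * Real.pi + 3120 * (4 * 10 + 2)) / 2 +
    (12 * Real.sqrt 2 * Real.pi + 2 * Real.sqrt 2 * Real.pi * ((10 - 1) / 2 + 4) + 36 * 10 + 288) / 52 +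
    Real.sqrt 2 * Real.pi * ((10 - 1) / 2 + 4) ^ 2 / (F true u) 2 / 52, 10, by norm_num, ?_⟩
  intro h hh ρ hρ X P₁ P₂ hX hP₁X hP₂X₁ hcyl hP₁ hP₂
  set φ₁ : ℝ := Real.sqrt 2 / 4 * ∑ᶠ w ∈ {w ∈ fccStacking 1 (Real.sqrt (2 / 3)) | ‖w‖ = 1},
      |⟪w, A₁.symm e₃⟫_ℝ| with hφ₁
  set φ₂ : ℝ := Real.sqrt 2 / 4 * ∑ᶠ w ∈ {w ∈ fccStacking 1 (Real.sqrt (2 / 3)) | ‖w‖ = 1},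
      |⟪w, A₂.symm e₃⟫_ℝ| with hφ₂
  have hP₂X : P₂ ⊆ X := hP₂X₁.trans sdiff_subset
  have hρ0 : (0 : ℝ) ≤ ρ := by linarith
  -- (1) the two slab samples from above
  have hD₁ := hC₁ (-(2 * 10)) (-10) (by norm_num) ρ hρ P₁ hP₁
  have hD₂ := hC₂ (h + 10) (h + 2 * 10) (by ring) ρ hρ P₂ hP₂
  -- (2) the interior ledger
  have hled := ledger_ge_faces_add_interior A₁ t₁ A₂ t₂ X P₁ P₂ 10 h ρ le_rfl hh hρ hX hcyl hP₁X hP₂X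
    hP₁ hP₂
  have hf₁ : Real.sqrt 2 / 4 * ∑ w ∈ fccSlots, |⟪A₁ w, e₃⟫_ℝ| = φ₁ := by
    rw [hφ₁, finsum_unit_fcc_symm_eq_sum_slots]
  have hf₂ : Real.sqrt 2 / 4 * ∑ w ∈ fccSlots, |⟪A₂ w, e₃⟫_ℝ| = φ₂ := by
    rw [hφ₂, finsum_unit_fcc_symm_eq_sum_slots]
  rw [hf₁, hf₂, ← two_mul_contactDeficiency_eq_sum X] at hled
  -- (3) the payers of the interior window, fed by the flux gap
  have hP₁' := hP₁
  have hP₂' := hP₂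
  simp only [e₁, e₂] at hP₁' hP₂'
  have hpay := fluxGap_twin_payers_ge hg hc L F hF hn huS hun hα₁pos hα₂pos s₁ s₂ X P₁ P₂ 10 h ρ
    le_rfl hh hρ hX hcyl hP₁X hP₂X hP₁' hP₂'
  rw [hdiff] at hpay
  have hPAY : ((X.filter fun z => (X.filter fun q => dist z q = 1).card ≤ 11 ∧
        -10 - 2 ≤ z 2 ∧ z 2 ≤ h + 10 + 2).card : ℝ) ≤
      ((X.filter fun y => (X.filter fun q => dist y q = 1).card ≠ 12 ∧
        -10 - 2 ≤ y 2 ∧ y 2 ≤ h + 10 + 2).card : ℝ) := by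
    exact_mod_cast card_le_card fun z hz => by
      rw [mem_filter] at hz ⊢
      exact ⟨hz.1, by have := hz.2.1; omega, hz.2.2⟩
  -- (4) the residual in the crux's terms
  have hGF : ∀ c, F c = L ∨ F c = RL := by
    intro c
    rcases hF with ⟨h0, h1⟩ | ⟨h0, h1⟩ <;> cases c <;> simp only [h0, h1, true_or, or_true]
  have hnn : ∀ n' : EuclideanSpace ℝ (Fin 3), n' ≠ n → n' ≠ -n → n' ≠ L e₃ ∧ n' ≠ -L e₃ := by
    intro n' h1 h2
    rcases hn with h' | h'
    · rw [h'] at h1 h2; exact ⟨h1, h2⟩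
    · rw [h'] at h1 h2; rw [neg_neg] at h2; exact ⟨h2, h1⟩
  have hFOR : ((X.filter fun b => ∃ c : Bool, ∃ n' : EuclideanSpace ℝ (Fin 3), ‖n'‖ = 1 ∧ n' ≠ n ∧
        n' ≠ -n ∧
        (∀ w ∈ fccSlots, ⟪F c w, n'⟫_ℝ = 0 ∨ ⟪F c w, n'⟫_ℝ = Real.sqrt (2 / 3) ∨
          ⟪F c w, n'⟫_ℝ = -Real.sqrt (2 / 3)) ∧
        (∀ w ∈ fccSlots, ⟪F c w, n'⟫_ℝ ≤ 0 → b + F c w ∈ X) ∧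
        (∀ w ∈ fccSlots, ⟪F c w, n'⟫_ℝ < 0 → b + (F c w - (2 * ⟪F c w, n'⟫_ℝ) • n') ∈ X) ∧
        (∀ w ∈ fccSlots, 0 < ⟪F c w, n'⟫_ℝ → b + F c w ∉ X)).card : ℝ) ≤
      ((X.filter fun b => ∃ G : EuclideanSpace ℝ (Fin 3) ≃ₗᵢ[ℝ] EuclideanSpace ℝ (Fin 3),
        (G = L ∨ G = RL) ∧ ∃ n' : EuclideanSpace ℝ (Fin 3), ‖n'‖ = 1 ∧ n' ≠ L e₃ ∧ n' ≠ -L e₃ ∧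
        (∀ w ∈ fccSlots, ⟪G w, n'⟫_ℝ = 0 ∨ ⟪G w, n'⟫_ℝ = Real.sqrt (2 / 3) ∨
          ⟪G w, n'⟫_ℝ = -Real.sqrt (2 / 3)) ∧
        (∀ w ∈ fccSlots, ⟪G w, n'⟫_ℝ ≤ 0 → b + G w ∈ X) ∧
        (∀ w ∈ fccSlots, ⟪G w, n'⟫_ℝ < 0 → b + (G w - (2 * ⟪G w, n'⟫_ℝ) • n') ∈ X) ∧
        (∀ w ∈ fccSlots, 0 < ⟪G w, n'⟫_ℝ → b + G w ∉ X)).card : ℝ) := by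
    exact_mod_cast card_le_card fun b hb => by
      rw [mem_filter] at hb ⊢
      obtain ⟨hbX, c, n', h1, h2, h3, h4, h5, h6, h7⟩ := hb
      exact ⟨hbX, F c, hGF c, n', h1, (hnn n' h2 h3).1, (hnn n' h2 h3).2, h4, h5, h6, h7⟩
  -- (5) the two splits of the skeleton
  have hs₁ := contactDeficiency_sdiff_split hP₁X
  have hs₂ := contactDeficiency_sdiff_split hP₂X₁
  -- (6) assemble
  have hπρ : 0 ≤ Real.pi * ρ ^ 2 := by positivity
  have hflux : Real.sqrt 6 / 3 * Real.sqrt (1 - ⟪L e₃, e₃⟫_ℝ ^ 2) * (Real.pi * ρ ^ 2) ≤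
      Real.sqrt 2 * (2 * dd) * (Real.pi * ρ ^ 2) := mul_le_mul_of_nonneg_right h63 hπρ
  have ha : C₁ * ρ ≤ |C₁| * (1 + h) * ρ := by
    have h1 : C₁ * ρ ≤ |C₁| * ρ := mul_le_mul_of_nonneg_right (le_abs_self _) hρ0
    have h2 : 0 ≤ |C₁| * h * ρ := by positivity
    linarith only [h1, h2]
  have hb : C₂ * ρ ≤ |C₂| * (1 + h) * ρ := by
    have h1 : C₂ * ρ ≤ |C₂| * ρ := mul_le_mul_of_nonneg_right (le_abs_self _) hρ0
    have h2 : 0 ≤ |C₂| * h * ρ := by positivity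
    linarith only [h1, h2]
  have hCE : (12 * Real.sqrt 2 * Real.pi + 2 * Real.sqrt 2 * Real.pi * ((10 - 1) / 2 + 4) + 36 * 10 + 288) * ρ ≤
      (12 * Real.sqrt 2 * Real.pi + 2 * Real.sqrt 2 * Real.pi * ((10 - 1) / 2 + 4) + 36 * 10 + 288) *
        (1 + h) * ρ := by
    have := mul_nonneg (mul_nonneg hCE0 hh) hρ0
    linarith only [this]
  have h1hρ : (1 : ℝ) ≤ (1 + h) * ρ := by
    have := mul_nonneg hh hρ0
    linarith only [this, hρ]
  have hCK : Real.sqrt 2 * Real.pi * ((10 - 1) / 2 + 4) ^ 2 / (F true u) 2 ≤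
      Real.sqrt 2 * Real.pi * ((10 - 1) / 2 + 4) ^ 2 / (F true u) 2 * (1 + h) * ρ := by
    have := mul_le_mul_of_nonneg_left h1hρ hCK0
    linarith only [this]
  -- name the four counts
  set PAY : Finset (EuclideanSpace ℝ (Fin 3)) := X.filter fun z => (X.filter fun q => dist z q = 1).card ≤ 11 ∧
    -10 - 2 ≤ z 2 ∧ z 2 ≤ h + 10 + 2
  set PAY' : Finset (EuclideanSpace ℝ (Fin 3)) := X.filter fun y => (X.filter fun q => dist y q = 1).card ≠ 12 ∧
    -10 - 2 ≤ y 2 ∧ y 2 ≤ h + 10 + 2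
  set FORb : Finset (EuclideanSpace ℝ (Fin 3)) := X.filter fun b => ∃ c : Bool, ∃ n' : EuclideanSpace ℝ (Fin 3),
      ‖n'‖ = 1 ∧ n' ≠ n ∧ n' ≠ -n ∧
      (∀ w ∈ fccSlots, ⟪F c w, n'⟫_ℝ = 0 ∨ ⟪F c w, n'⟫_ℝ = Real.sqrt (2 / 3) ∨
        ⟪F c w, n'⟫_ℝ = -Real.sqrt (2 / 3)) ∧
      (∀ w ∈ fccSlots, ⟪F c w, n'⟫_ℝ ≤ 0 → b + F c w ∈ X) ∧
      (∀ w ∈ fccSlots, ⟪F c w, n'⟫_ℝ < 0 → b + (F c w - (2 * ⟪F c w, n'⟫_ℝ) • n') ∈ X) ∧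
      (∀ w ∈ fccSlots, 0 < ⟪F c w, n'⟫_ℝ → b + F c w ∉ X)
  set FORL : Finset (EuclideanSpace ℝ (Fin 3)) := X.filter fun b =>
      ∃ G : EuclideanSpace ℝ (Fin 3) ≃ₗᵢ[ℝ] EuclideanSpace ℝ (Fin 3),
      (G = L ∨ G = RL) ∧ ∃ n' : EuclideanSpace ℝ (Fin 3), ‖n'‖ = 1 ∧ n' ≠ L e₃ ∧ n' ≠ -L e₃ ∧
      (∀ w ∈ fccSlots, ⟪G w, n'⟫_ℝ = 0 ∨ ⟪G w, n'⟫_ℝ = Real.sqrt (2 / 3) ∨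
        ⟪G w, n'⟫_ℝ = -Real.sqrt (2 / 3)) ∧
      (∀ w ∈ fccSlots, ⟪G w, n'⟫_ℝ ≤ 0 → b + G w ∈ X) ∧
      (∀ w ∈ fccSlots, ⟪G w, n'⟫_ℝ < 0 → b + (G w - (2 * ⟪G w, n'⟫_ℝ) • n') ∈ X) ∧
      (∀ w ∈ fccSlots, 0 < ⟪G w, n'⟫_ℝ → b + G w ∉ X)
  have t1 : ((((P₁ ×ˢ (X \ P₁)).filter fun pq => dist pq.1 pq.2 = 1).card : ℕ) : ℝ) +
      ((((P₂ ×ˢ ((X \ P₁) \ P₂)).filter fun pq => dist pq.1 pq.2 = 1).card : ℕ) : ℝ) =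
      contactDeficiency P₁ + contactDeficiency P₂ + contactDeficiency ((X \ P₁) \ P₂) -
        contactDeficiency X := by linarith only [hs₁, hs₂]
  have t2 : Real.sqrt 6 / 3 * Real.sqrt (1 - ⟪L e₃, e₃⟫_ℝ ^ 2) * (Real.pi * ρ ^ 2) -
      (12 * Real.sqrt 2 * Real.pi + 2 * Real.sqrt 2 * Real.pi * ((10 - 1) / 2 + 4) + 36 * 10 + 288) * ρ -
      Real.sqrt 2 * Real.pi * ((10 - 1) / 2 + 4) ^ 2 / (F true u) 2 ≤
      26 * (PAY'.card : ℝ) + 2 * (FORL.card : ℝ) := by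
    linarith only [hpay, hflux, hPAY, hFOR]
  have t3 : 2 * φ₁ * Real.pi * ρ ^ 2 + 2 * φ₂ * Real.pi * ρ ^ 2 + (PAY'.card : ℝ) -
      (240 * Real.sqrt 2 * Real.pi + 3120 * (4 * 10 + 2)) * (1 + h) * ρ ≤ 2 * contactDeficiency X := by
    linarith only [hled]
  have t4 : contactDeficiency P₁ ≤ 2 * φ₁ * Real.pi * ρ ^ 2 + C₁ * ρ := hD₁
  have t5 : contactDeficiency P₂ ≤ 2 * φ₂ * Real.pi * ρ ^ 2 + C₂ * ρ := hD₂
  linarith only [t1, t2, t3, t4, t5, ha, hb, hCE, hCK]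

end Summit.Ventures.Crystal3D.Theorems

end
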